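import Mathlib
import Summits.Ventures.PercRepro2.LocRows
import Summits.Ventures.PercRepro2.SwRow
import Summits.Ventures.PercRepro2.SwOut
import Summits.Ventures.PercRepro2.SwAllRow
import Summits.Ventures.PercRepro2.SwOutAll
import Summits.Ventures.PercRepro2.SwOutArmFlip
import Summits.Ventures.PercRepro2.SwOutArmThm
import Summits.Ventures.PercRepro2.SwOutCoreDefs
import Summits.Ventures.PercRepro2.SwOutCoreHull
import Summits.Ventures.PercRepro2.SwOutShadowDefs
import Summits.Ventures.PercRepro2.SwOutCoreShadowDefs

/-!
# The shadow cube of a one-sided point, as flips of core-cube points (blind cell PercRepro2,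
night-4 g13, 2026-08-26; proofs/NIGHT4-G12.md §2 (2.2), proofs/NIGHT4-G13.md §4 (S))

The flip algebra relating the shadow cube of a one-sided point `ω₀` of a core cube to the core
cube itself: flips of vertex sets commute (`flip_comm`), split over unions no edge straddles
(`flip_union_of_not_both`), and the shadow base satisfies
`flip (sX ∪ sZ) (shadowOf ζ) = flip sX (flip sZ ζ)` (`flip_sXZ_shadowOf`: an edge touching both
`sX` and `sZ` joins `u` to a dropped arm).  Hence every shadow point is a flip of a core-cube point
(`shadowReal_eq_flip_coreReal_false` / `_true`): the X-blue half is `flip sX` of the core points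
whose u-adjacent arms are coloured as at `ω₀`, the X-red half is `flip (sX ∪ sZ) ∘ flip sX` of them
— the two escaping states of NIGHT4-G12.md (2.2), `ζ_b` and `ζ_o`.
-/

namespace Summit.Ventures.PercRepro2

namespace LocRows

open Hull

variable {V : Type*} {E : Type*}

open scoped Classical

variable {ends : E → Sym2 V}

/-- Flips of vertex sets commute. -/
lemma flip_comm (P Q : Set V) (ζ : Config E) : flip ends P (flip ends Q ζ) = flip ends Q (flip ends P ζ) := by
  funext e
  by_cases hP : e ∈ touches ends P <;> by_cases hQ : e ∈ touches ends Q <;>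
    simp [flip_apply_of_mem, flip_apply_of_notMem, hP, hQ]

/-- A flip of a union no edge straddles is the composition of the flips. -/
lemma flip_union_of_not_both {P Q : Set V} (h : ∀ e, e ∈ touches ends P → e ∈ touches ends Q → False)
    (ζ : Config E) : flip ends (P ∪ Q) ζ = flip ends P (flip ends Q ζ) := by
  funext e
  by_cases hP : e ∈ touches ends P
  · have hQ : e ∉ touches ends Q := fun hQ => h e hP hQ
    rw [flip_apply_of_mem (touches_mono Set.subset_union_left hP), flip_apply_of_mem hP,
      flip_apply_of_notMem hQ]
  · by_cases hQ : e ∈ touches ends Q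
    · rw [flip_apply_of_mem (touches_mono Set.subset_union_right hQ), flip_apply_of_notMem hP,
        flip_apply_of_mem hQ]
    · rw [flip_apply_of_notMem, flip_apply_of_notMem hP, flip_apply_of_notMem hQ]
      rintro ⟨x, hx, y, hxy⟩
      rcases hx with hx | hx
      · exact hP ⟨x, hx, y, hxy⟩
      · exact hQ ⟨x, hx, y, hxy⟩

section Flip

variable {ι : Type*} {A : ι → Set V} {pure : ι → Prop} {ζ : Config E} {h u : V} {H : Set V}
  (hb : CoreBase ends ζ h u H A pure) {ω₀ : Config ι}
include hb

/-- An edge touching both `sX` and `sZ` joins `u` to a dropped arm. -/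
lemma CoreBase.uZ_of_touches_sX_sZ {e : E} (hX : e ∈ touches ends (sX ends u A ω₀))
    (hZ : e ∈ touches ends (sZ ends u A ω₀)) : ∃ z ∈ sZ ends u A ω₀, ends e = s(u, z) := by
  obtain ⟨x, hx, y, hxy⟩ := hX
  obtain ⟨z, hz, w, hzw⟩ := hZ
  obtain ⟨j, hj, hωj, hzj⟩ := hz
  have hzX : z ∉ sX ends u A ω₀ := by
    intro hzX
    rcases mem_sX_iff.1 hzX with rfl | ⟨i, _, hωi, hzi⟩
    · exact hb.u_notMem_arm j hzj
    · have : i = j := by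
        by_contra hne
        exact hb.arm_disj i j hne z hzi hzj
      subst this
      rw [hωi] at hωj; exact absurd hωj (by decide)
  rw [hxy, Sym2.eq_iff] at hzw
  rcases hzw with ⟨h1, _⟩ | ⟨_, h2⟩
  · exact absurd (h1 ▸ hx) hzX
  · -- `y = z ∈ A j`, `x ∈ sX`: the edge leaves from `u`
    rw [← h2] at hzj
    have hxu : x = u := hb.eq_u_of_edge_sX hxy hx hzj (fun h' => by
      rw [h'.2] at hωj; exact absurd hωj (by decide))
    subst hxu
    exact ⟨y, ⟨j, hj, hωj, hzj⟩, hxy⟩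

omit hb in
/-- A `u`–`sZ` edge touches `sX` and `sZ`. -/
lemma CoreBase.touches_of_uZ {e : E} {z : V} (hz : z ∈ sZ ends u A ω₀) (he : ends e = s(u, z)) :
    e ∈ touches ends (sX ends u A ω₀) ∧ e ∈ touches ends (sZ ends u A ω₀) :=
  ⟨⟨u, mem_sX_iff.2 (Or.inl rfl), z, he⟩, ⟨z, hz, u, ends_swap he⟩⟩

/-- **`flip (sX ∪ sZ) (shadowOf ζ) = flip sX (flip sZ ζ)`.** -/
theorem CoreBase.flip_sXZ_shadowOf :
    flip ends (sX ends u A ω₀ ∪ sZ ends u A ω₀) (shadowOf ends u A ω₀ ζ) =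
      flip ends (sX ends u A ω₀) (flip ends (sZ ends u A ω₀) ζ) := by
  funext e
  by_cases hX : e ∈ touches ends (sX ends u A ω₀) <;> by_cases hZ : e ∈ touches ends (sZ ends u A ω₀)
  · obtain ⟨z, hz, he⟩ := hb.uZ_of_touches_sX_sZ hX hZ
    rw [flip_apply_of_mem (touches_mono Set.subset_union_left hX), shadowOf_apply_of_mem_sZ hz he,
      flip_apply_of_mem hX, flip_apply_of_mem hZ]
  · have hnot : ¬ ∃ z ∈ sZ ends u A ω₀, ends e = s(u, z) := by
      rintro ⟨z, hz, he⟩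
      exact hZ (CoreBase.touches_of_uZ hz he).2
    rw [flip_apply_of_mem (touches_mono Set.subset_union_left hX), shadowOf_apply_of_not hnot,
      flip_apply_of_mem hX, flip_apply_of_notMem hZ]
  · have hnot : ¬ ∃ z ∈ sZ ends u A ω₀, ends e = s(u, z) := by
      rintro ⟨z, hz, he⟩
      exact hX (CoreBase.touches_of_uZ hz he).1
    rw [flip_apply_of_mem (touches_mono Set.subset_union_right hZ), shadowOf_apply_of_not hnot,
      flip_apply_of_notMem hX, flip_apply_of_mem hZ]
  · have hnot : ¬ ∃ z ∈ sZ ends u A ω₀, ends e = s(u, z) := by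
      rintro ⟨z, hz, he⟩
      exact hX (CoreBase.touches_of_uZ hz he).1
    rw [flip_apply_of_notMem, shadowOf_apply_of_not hnot, flip_apply_of_notMem hX,
      flip_apply_of_notMem hZ]
    rintro ⟨x, hx, y, hxy⟩
    rcases hx with hx | hx
    · exact hX ⟨x, hx, y, hxy⟩
    · exact hZ ⟨x, hx, y, hxy⟩

/-- The far arms assigned `false` by a shadow point. -/
def farFalse (ω' : Config (Option {i : ι // ¬ uAdjC ends u A i})) : Set V :=
  {x | ∃ i : {i : ι // ¬ uAdjC ends u A i}, ω' (some i) = false ∧ x ∈ A i.1}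

omit hb in
/-- `shadowFalse` of a shadow point: the far arms assigned `false`, with `sX ∪ sZ` when the
coordinate `none` is `false`. -/
lemma shadowFalse_eq (ω' : Config (Option {i : ι // ¬ uAdjC ends u A i})) :
    shadowFalse (sB ends u A ω₀) (sZ ends u A ω₀) none ω' =
      farFalse (A := A) ω' ∪ {x | ω' none = false ∧ x ∈ sX ends u A ω₀ ∪ sZ ends u A ω₀} := by
  ext x
  simp only [shadowFalse, farFalse, Set.mem_union, Set.mem_setOf_eq]
  constructor
  · rintro (⟨j, hj, hx⟩ | ⟨hk, hx⟩)
    · rcases j with _ | i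
      · simp only [sB] at hx
        exact Or.inr ⟨hj, Or.inl hx⟩
      · exact Or.inl ⟨i, hj, hx⟩
    · exact Or.inr ⟨hk, Or.inr hx⟩
  · rintro (⟨i, hi, hx⟩ | ⟨hk, hx | hx⟩)
    · exact Or.inl ⟨some i, hi, hx⟩
    · exact Or.inl ⟨none, hk, by simp only [sB]; exact hx⟩
    · exact Or.inr ⟨hk, hx⟩

/-- No edge joins a far arm to `sX ∪ sZ`. -/
lemma CoreBase.not_touches_far_sXZ (ω' : Config (Option {i : ι // ¬ uAdjC ends u A i})) :
    ∀ e, e ∈ touches ends (farFalse (A := A) ω') →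
      e ∈ touches ends (sX ends u A ω₀ ∪ sZ ends u A ω₀) → False := by
  rintro e ⟨x, ⟨i, _, hxi⟩, y, hxy⟩ ⟨z, hz, w, hzw⟩
  have hzi : z ∉ A i.1 := by
    intro hzi
    rcases hz with hz | hz
    · rcases mem_sX_iff.1 hz with rfl | ⟨j, hj, _, hzj⟩
      · exact hb.u_notMem_arm i.1 hzi
      · have : i.1 = j := by
          by_contra hne
          exact hb.arm_disj i.1 j hne z hzi hzj
        exact i.2 (this ▸ hj)
    · obtain ⟨j, hj, _, hzj⟩ := hz
      have : i.1 = j := by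
        by_contra hne
        exact hb.arm_disj i.1 j hne z hzi hzj
      exact i.2 (this ▸ hj)
  rw [hxy, Sym2.eq_iff] at hzw
  rcases hzw with ⟨h1, _⟩ | ⟨_, h2⟩
  · exact hzi (h1 ▸ hxi)
  · -- `z = y` is joined to `x ∈ A i`: `z ∈ sX ∪ sZ`, so `z = u` or `z` in a u-adjacent arm
    rw [← h2] at hz
    rcases hz with hz | hz
    · rcases mem_sX_iff.1 hz with rfl | ⟨j, hj, _, hyj⟩
      · exact i.2 ⟨e, x, ends_swap hxy, hxi⟩
      · have : i.1 = j := hb.arm_eq_of_edge hxy hxi hyj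
        exact i.2 (this ▸ hj)
    · obtain ⟨j, hj, _, hyj⟩ := hz
      have : i.1 = j := hb.arm_eq_of_edge hxy hxi hyj
      exact i.2 (this ▸ hj)

omit hb in
/-- The far arms assigned `false` by a core point agreeing with `ω₀` on the u-adjacent arms. -/
lemma CoreBase.armsFalseC_eq (ω : Config ι) (hω : ∀ i, uAdjC ends u A i → ω i = ω₀ i)
    (ω' : Config (Option {i : ι // ¬ uAdjC ends u A i})) (hω' : ∀ i, ω' (some i) = ω i.1) :
    armsFalseC A ω = farFalse (A := A) ω' ∪ sZ ends u A ω₀ := by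
  ext x
  simp only [armsFalseC, farFalse, Set.mem_union, Set.mem_setOf_eq]
  constructor
  · rintro ⟨i, hi, hx⟩
    by_cases hadj : uAdjC ends u A i
    · exact Or.inr ⟨i, hadj, by rw [← hω i hadj]; exact hi, hx⟩
    · exact Or.inl ⟨⟨i, hadj⟩, by rw [hω']; exact hi, hx⟩
  · rintro (⟨i, hi, hx⟩ | ⟨i, hadj, hi, hx⟩)
    · exact ⟨i.1, by rw [← hω' i]; exact hi, hx⟩
    · exact ⟨i, by rw [hω i hadj]; exact hi, hx⟩

/-- **The X-blue half of the shadow cube**: the shadow point with `none ↦ false` and the far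
colouring of a core point `ω` (agreeing with `ω₀` on the u-adjacent arms) is `flip sX` of that
core point — the state `ζ_b`. -/
theorem CoreBase.shadowReal_eq_flip_coreReal_false (ω : Config ι)
    (hω : ∀ i, uAdjC ends u A i → ω i = ω₀ i)
    (ω' : Config (Option {i : ι // ¬ uAdjC ends u A i})) (hnone : ω' none = false)
    (hω' : ∀ i, ω' (some i) = ω i.1) :
    shadowReal ends (sB ends u A ω₀) (sZ ends u A ω₀) none (shadowOf ends u A ω₀ ζ) ω' =
      flip ends (sX ends u A ω₀) (coreReal ends A ζ ω) := by
  unfold shadowReal coreReal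
  rw [shadowFalse_eq, CoreBase.armsFalseC_eq ω hω ω' hω']
  have hset : {x | ω' none = false ∧ x ∈ sX ends u A ω₀ ∪ sZ ends u A ω₀} =
      sX ends u A ω₀ ∪ sZ ends u A ω₀ := by
    ext x; simp [hnone]
  rw [hset, flip_union_of_not_both (hb.not_touches_far_sXZ ω'), hb.flip_sXZ_shadowOf,
    flip_union_of_not_both (fun e h1 h2 => hb.not_touches_far_sXZ ω' e h1
      (touches_mono Set.subset_union_right h2)), flip_comm (farFalse ω')]

/-- **The X-red half of the shadow cube**: the shadow point with `none ↦ true` and the far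
colouring of a core point `ω` (agreeing with `ω₀` on the u-adjacent arms) is
`flip (sX ∪ sZ) (flip sX _)` of that core point — the state `ζ_o`. -/
theorem CoreBase.shadowReal_eq_flip_coreReal_true (ω : Config ι)
    (hω : ∀ i, uAdjC ends u A i → ω i = ω₀ i)
    (ω' : Config (Option {i : ι // ¬ uAdjC ends u A i})) (hnone : ω' none = true)
    (hω' : ∀ i, ω' (some i) = ω i.1) :
    shadowReal ends (sB ends u A ω₀) (sZ ends u A ω₀) none (shadowOf ends u A ω₀ ζ) ω' =
      flip ends (sX ends u A ω₀ ∪ sZ ends u A ω₀)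
        (flip ends (sX ends u A ω₀) (coreReal ends A ζ ω)) := by
  unfold shadowReal coreReal
  rw [shadowFalse_eq, CoreBase.armsFalseC_eq ω hω ω' hω']
  have hset : {x | ω' none = false ∧ x ∈ sX ends u A ω₀ ∪ sZ ends u A ω₀} = (∅ : Set V) := by
    ext x; simp [hnone]
  rw [hset, Set.union_empty,
    flip_union_of_not_both (fun e h1 h2 => hb.not_touches_far_sXZ ω' e h1
      (touches_mono Set.subset_union_right h2)), flip_comm (sX ends u A ω₀),
    flip_comm (sX ends u A ω₀ ∪ sZ ends u A ω₀), ← hb.flip_sXZ_shadowOf, Hull.flip_flip]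

end Flip

end LocRows

end Summit.Ventures.PercRepro2
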